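import Mathlib
import Summits.NavierStokesRegularity.NavierStokesRegularity.Theorems.LandauTailLandauTailBlowupDefectInequality
import Summits.NavierStokesRegularity.NavierStokesRegularity.Theorems.LandauTailLandauTailBlowupDefectFloorEngine
import Summits.NavierStokesRegularity.NavierStokesRegularity.Theorems.LandauTailLandauTailBlowupLandauPairing
import Summits.NavierStokesRegularity.NavierStokesRegularity.Theorems.LandauTailLandauTailBlowupReynoldsPrep

/-!
# Crux `LandauTail.LandauTailBlowup` (stmt-NavierStokesRegularity-1944), line `registered`, cycle c6:
  stub `landauTail_reynolds_defect_tendsto` — the Reynolds-stress defect identity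

Lead file (c6). THEOREM (equality form of the quantitative flux theorem): for the Landau jet
`U = landauAxisField a A` and fields `u n`, continuous on the slab `(−1,0) × ℝ³`, satisfying the very weak Navier–Stokes
identity against a solenoidal test `ψ` supported in `S = (s₁,s₂) × B_ρ ⊆ Q₁`, with `w n = u n − U` BOUNDED in `L²(S)` and
`u n → U` a.e. on `S`: `∫∫ ⟪w n, (∇ψ) w n⟫ → 2π β(A) ∫ ⟪a, ψ(t, 0)⟫ dt` — the Reynolds stress of the defect converges, in
the solenoidal distributional sense, to LANDAU'S POINT FORCE `β(A) a ⊗ δ_{axis}`. Proof: exact split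
`F(u n) − F(U) = Lin n + ⟪w n,(∇ψ)w n⟫`, `∫∫F(u n) = 0`, `∫∫|Lin n| → 0` (`landauTail_linear_terms_tendsto_zero`), and
`∫∫F(U) = −2πβ(A)∫⟪a,ψ(t,0)⟫dt` (`landauTail_veryWeak_landau_pairing`). References: Landau 1944; Lemarié-Rieusset 2016
(10.48); Chae 2007 p. 8; KNSS 2009 §4 (ii); P.-L. Lions 1996 §1.4 (defect measures).
-/

set_option linter.dupNamespace false

noncomputable section

open MeasureTheory Set Function Filter Metric TopologicalSpace InnerProductSpace
open scoped NNReal ENNReal Topology RealInnerProductSpace Laplacian ContDiff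
open Literature.Analysis.FluidPDE

namespace Summit.NavierStokesRegularity.NavierStokesRegularity.Theorems

/-- **The Reynolds-stress defect identity** (registered support stub R1 of crux stmt-NavierStokesRegularity-1944, lead
c6): along `L²(S)`-bounded, a.e.-convergent approximations of the Landau jet by fields satisfying the very weak
Navier–Stokes identity, `∫∫ ⟪u n − U, (∇ψ)(u n − U)⟫ → 2πβ(A) ∫ ⟪a, ψ(t,0)⟫ dt` for every solenoidal test `ψ`
supported in `S` (Landau 1944; Lemarié-Rieusset 2016 (10.48); Chae 2007 p. 8; KNSS 2009 §4 (ii)). -/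
theorem landauTail_reynolds_defect_tendsto : ∀ (u : ℕ → ℝ → EuclideanSpace ℝ (Fin 3) → EuclideanSpace ℝ (Fin 3)) (a : EuclideanSpace ℝ (Fin 3)) (A : ℝ) (ψ : ℝ → EuclideanSpace ℝ (Fin 3) → EuclideanSpace ℝ (Fin 3)) (s₁ s₂ ρ : ℝ) (C : NNReal), ‖a‖ = 1 → 1 < A → -1 ≤ s₁ → s₁ < s₂ → s₂ ≤ 0 → 0 < ρ → ρ ≤ 1 → (∀ n, ContinuousOn (Function.uncurry (u n)) (Set.Ioo (-1 : ℝ) 0 ×ˢ Set.univ)) → Literature.Analysis.FluidPDE.IsSpaceTimeTestOn (Literature.Analysis.FluidPDE.parabolicCylinderOpens 1 ((0 : ℝ), (0 : EuclideanSpace ℝ (Fin 3)))) ψ → tsupport (Function.uncurry ψ) ⊆ Set.Ioo s₁ s₂ ×ˢ Metric.ball (0 : EuclideanSpace ℝ (Fin 3)) ρ → (∀ t x, Literature.Analysis.FluidPDE.VectorCalculus.divergence (ψ t) x = 0) → (∀ n, ∫ t in Set.Ioo (-1 : ℝ) 0, ∫ x, (inner ℝ (u n t x) (Literature.Analysis.FluidPDE.timeDeriv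 ψ t x) + inner ℝ (u n t x) (Literature.Analysis.FluidPDE.convect (u n t) (ψ t) x) + 1 * inner ℝ (u n t x) (Laplacian.laplacian (ψ t) x)) = 0) → (∀ n, MeasureTheory.eLpNorm (fun z : ℝ × EuclideanSpace ℝ (Fin 3) => u n z.1 z.2 - Literature.Analysis.FluidPDE.landauAxisField a A z.2) 2 (MeasureTheory.volume.restrict (Set.Ioo s₁ s₂ ×ˢ Metric.ball (0 : EuclideanSpace ℝ (Fin 3)) ρ)) ≤ C) → (∀ᵐ z ∂(MeasureTheory.volume.restrict (Set.Ioo s₁ s₂ ×ˢ Metric.ball (0 : EuclideanSpace ℝ (Fin 3)) ρ)), Filter.Tendsto (fun n => u n z.1 z.2) Filter.atTop (nhds (Literature.Analysis.FluidPDE.landauAxisField a A z.2))) → Filter.Tendsto (fun n => ∫ t in Set.Ioo (-1 : ℝ) 0, ∫ x, inner ℝ (u n t x - Literature.Analysis.FluidPDE.landauAxisField a A x) ((fderiv ℝ (ψ t) x) (u n t x - Literature.Analysis.FluidPDE.landauAxisField a A x))) Filter.atTop (nhds ((2 * Real.pi * (8 * A / 3 * (3 * A ^ 2 + 1) / (A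 ^ 2 - 1) - 4 * A ^ 2 * Real.log ((A + 1) / (A - 1)))) * ∫ t in Set.Ioo (-1 : ℝ) 0, inner ℝ a (ψ t 0))) := by
  intro u a A ψ s₁ s₂ ρ C ha hA hs₁ hs₁₂ hs₂ hρ hρ1 huc hψ hS hdiv hid hbd hae
  -- the Landau jet and its profile properties
  set V : EuclideanSpace ℝ (Fin 3) → EuclideanSpace ℝ (Fin 3) := landauAxisField a A with hVdef
  obtain ⟨hVs, -, -, -, hhom, -⟩ := landauTail_landauAxisField_profile ha hA
  have hVc : ContinuousOn V {0}ᶜ := hVs.continuousOn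
  have hVm : AEStronglyMeasurable V volume := (landauTail_profile_measurable hVc).aestronglyMeasurable
  have hV2 := landauTail_eLpNorm_profile_two_lt_top hVc hhom
  have hV52 := landauTail_eLpNorm_profile_five_halves_lt_top hVc hhom
  set Φ : ℝ := 2 * Real.pi * (8 * A / 3 * (3 * A ^ 2 + 1) / (A ^ 2 - 1) - 4 * A ^ 2 * Real.log ((A + 1) / (A - 1)))
  -- the very weak value of the jet (R0)
  have hpair : ∫ t in Ioo (-1 : ℝ) 0, ∫ x, (⟪V x, timeDeriv ψ t x⟫ + ⟪V x, convect V (ψ t) x⟫ +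
      1 * ⟪V x, Δ (ψ t) x⟫) = -Φ * ∫ t in Ioo (-1 : ℝ) 0, ⟪a, ψ t 0⟫ :=
    landauTail_veryWeak_landau_pairing a A ψ ha hA hψ hdiv
  -- notation
  set S : Set (ℝ × EuclideanSpace ℝ (Fin 3)) := Ioo s₁ s₂ ×ˢ ball (0 : EuclideanSpace ℝ (Fin 3)) ρ with hSdef
  have hSm : MeasurableSet S := measurableSet_Ioo.prod measurableSet_ball
  have hSslab : S ⊆ Ioo (-1 : ℝ) 0 ×ˢ (univ : Set (EuclideanSpace ℝ (Fin 3))) := by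
    rintro ⟨t, x⟩ ⟨⟨ht1, ht2⟩, -⟩
    exact ⟨⟨lt_of_lt_of_le' ht1 hs₁, lt_of_lt_of_le ht2 hs₂⟩, mem_univ _⟩
  set μS : Measure (ℝ × EuclideanSpace ℝ (Fin 3)) := volume.restrict S with hμS
  haveI hμSfin : IsFiniteMeasure μS := by
    refine ⟨?_⟩
    rw [hμS, Measure.restrict_apply_univ, hSdef, Measure.volume_eq_prod, Measure.prod_prod, Real.volume_Ioo]
    exact ENNReal.mul_lt_top ENNReal.ofReal_lt_top measure_ball_lt_top
  set Fn : (ℝ → EuclideanSpace ℝ (Fin 3) → EuclideanSpace ℝ (Fin 3)) → ℝ → EuclideanSpace ℝ (Fin 3) → ℝ :=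
    fun v t x => ⟪v t x, timeDeriv ψ t x⟫ + ⟪v t x, fderiv ℝ (ψ t) x (v t x)⟫ + 1 * ⟪v t x, Δ (ψ t) x⟫ with hFn
  have hid' : ∀ n, ∫ t in Ioo (-1 : ℝ) 0, ∫ x, Fn (u n) t x = 0 := hid
  have hpair' : ∫ t in Ioo (-1 : ℝ) 0, ∫ x, Fn (fun _ => V) t x = -Φ * ∫ t in Ioo (-1 : ℝ) 0, ⟪a, ψ t 0⟫ := hpair
  set w : ℕ → ℝ × EuclideanSpace ℝ (Fin 3) → EuclideanSpace ℝ (Fin 3) := fun n z => u n z.1 z.2 - V z.2 with hw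
  -- the quadratic defect and the linear part
  set Q : ℕ → ℝ → EuclideanSpace ℝ (Fin 3) → ℝ := fun n t x =>
    ⟪u n t x - V x, fderiv ℝ (ψ t) x (u n t x - V x)⟫ with hQ
  set Lin : ℕ → ℝ → EuclideanSpace ℝ (Fin 3) → ℝ := fun n t x =>
    Fn (u n) t x - Fn (fun _ => V) t x - Q n t x with hLin
  show Tendsto (fun n => ∫ t in Ioo (-1 : ℝ) 0, ∫ x, Q n t x) atTop (𝓝 (Φ * ∫ t in Ioo (-1 : ℝ) 0, ⟪a, ψ t 0⟫))
  have hLin_eq : ∀ n t x, Lin n t x = ⟪u n t x - V x, timeDeriv ψ t x⟫ +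
      ⟪u n t x - V x, fderiv ℝ (ψ t) x (V x)⟫ + ⟪V x, fderiv ℝ (ψ t) x (u n t x - V x)⟫ +
        1 * ⟪u n t x - V x, Δ (ψ t) x⟫ := by
    intro n t x
    simp only [hLin, hFn, hQ, inner_sub_left, map_sub, inner_sub_right]
    ring
  -- Step 0: support and time window
  have hQ₁ : ∀ z : ℝ × EuclideanSpace ℝ (Fin 3),
      z ∈ (parabolicCylinderOpens 1 ((0 : ℝ), (0 : EuclideanSpace ℝ (Fin 3))) : Set _) →
      z.1 ∈ Ioo (-1 : ℝ) 0 ∧ z.2 ∈ ball (0 : EuclideanSpace ℝ (Fin 3)) 1 := by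
    intro z hz
    rw [coe_parabolicCylinderOpens, mem_parabolicCylinder] at hz
    obtain ⟨⟨h1, h2⟩, h3⟩ := hz
    exact ⟨⟨by linarith, by simpa using h2⟩, by simpa [mem_ball] using h3⟩
  have hψ' : IsSpaceTimeTestOn (slab (EuclideanSpace ℝ (Fin 3)) (Ioo (-1 : ℝ) 0) isOpen_Ioo) ψ :=
    hψ.mono fun z hz => mem_slab.2 (hQ₁ z hz).1
  obtain ⟨a', b', ha', -, hb', hsupp⟩ := hψ'.exists_time_support_Ioo (by norm_num)
  set a₁ : ℝ := (-1 + a') / 2 with ha₁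
  set b₁ : ℝ := b' / 2 with hb₁
  have h1a₁ : -1 < a₁ := by rw [ha₁]; linarith
  have ha₁a' : a₁ < a' := by rw [ha₁]; linarith
  have hb'b₁ : b' < b₁ := by rw [hb₁]; linarith
  have hb₁0 : b₁ < 0 := by rw [hb₁]; linarith
  have hIcc : Icc a₁ b₁ ⊆ Ioo (-1) 0 := fun t ht => ⟨h1a₁.trans_le ht.1, ht.2.trans_lt hb₁0⟩
  have hIoo : Ioo a₁ b₁ ⊆ Ioo (-1) 0 := Ioo_subset_Icc_self.trans hIcc
  obtain ⟨M₀, -, hM₀⟩ := hψ.exists_uniform_bound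
  have hMt : ∀ t x, ‖timeDeriv ψ t x‖ ≤ M₀ ∧ ‖fderiv ℝ (ψ t) x‖ ≤ M₀ ∧ ‖Δ (ψ t) x‖ ≤ M₀ := hM₀
  have hzero_S : ∀ t x, (t, x) ∉ S →
      timeDeriv ψ t x = 0 ∧ fderiv ℝ (ψ t) x = 0 ∧ Δ (ψ t) x = 0 := fun t x hz =>
    derived_eq_zero_of_notMem_tsupport fun h => hz (hS h)
  have hzero_x : ∀ t, ∀ x ∉ ball (0 : EuclideanSpace ℝ (Fin 3)) 1,
      timeDeriv ψ t x = 0 ∧ fderiv ℝ (ψ t) x = 0 ∧ Δ (ψ t) x = 0 := fun t x hx =>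
    hzero_S t x fun hz => hx (ball_subset_ball hρ1 hz.2)
  have hzero_t : ∀ t, t ∉ Icc a' b' → ∀ x,
      timeDeriv ψ t x = 0 ∧ fderiv ℝ (ψ t) x = 0 ∧ Δ (ψ t) x = 0 := by
    intro t ht x
    refine derived_eq_zero_of_notMem_tsupport (notMem_tsupport_iff_eventuallyEq.2 ?_)
    have hopen : IsOpen ((Icc a' b')ᶜ ×ˢ (univ : Set (EuclideanSpace ℝ (Fin 3)))) :=
      isClosed_Icc.isOpen_compl.prod isOpen_univ
    filter_upwards [hopen.mem_nhds (mk_mem_prod ht (mem_univ x))] with z hz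
    have hz1 : z.1 ∉ Icc a' b' := hz.1
    simp only [uncurry, hsupp z.1 hz1, Pi.zero_apply]
  have hFn0_t : ∀ v t, t ∉ Icc a' b' → ∀ x, Fn v t x = 0 := by
    intro v t ht x
    obtain ⟨h1, h2, h3⟩ := hzero_t t ht x
    simp only [hFn, h1, h2, h3, inner_zero_right, zero_apply, mul_zero, add_zero]
  have hFn0_S : ∀ v t x, (t, x) ∉ S → Fn v t x = 0 := by
    intro v t x hz
    obtain ⟨h1, h2, h3⟩ := hzero_S t x hz
    simp only [hFn, h1, h2, h3, inner_zero_right, zero_apply, mul_zero, add_zero]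
  have hFn0_x : ∀ v t, ∀ x ∉ ball (0 : EuclideanSpace ℝ (Fin 3)) 1, Fn v t x = 0 := by
    intro v t x hx
    obtain ⟨h1, h2, h3⟩ := hzero_x t x hx
    simp only [hFn, h1, h2, h3, inner_zero_right, zero_apply, mul_zero, add_zero]
  have hQ0_t : ∀ n t, t ∉ Icc a' b' → ∀ x, Q n t x = 0 := fun n t ht x => by
    simp only [hQ, (hzero_t t ht x).2.1, zero_apply, inner_zero_right]
  have hQ0_S : ∀ n t x, (t, x) ∉ S → Q n t x = 0 := fun n t x hz => by
    simp only [hQ, (hzero_S t x hz).2.1, zero_apply, inner_zero_right]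
  have hLin0_S : ∀ n t x, (t, x) ∉ S → Lin n t x = 0 := by
    intro n t x hz
    simp only [hLin, hFn0_S (u n) t x hz, hFn0_S (fun _ => V) t x hz, hQ0_S n t x hz, sub_zero]
  have hreduce : ∀ v, ∫ t in Ioo (-1 : ℝ) 0, ∫ x, Fn v t x = ∫ t in Ioo a₁ b₁, ∫ x, Fn v t x := by
    intro v
    refine setIntegral_eq_of_subset_of_forall_sdiff_eq_zero measurableSet_Ioo hIoo fun t ht => ?_
    have ht' : t ∉ Icc a' b' := fun h' => ht.2 ⟨ha₁a'.trans_le h'.1, h'.2.trans_lt hb'b₁⟩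
    simp only [hFn0_t v t ht', integral_zero]
  have hreduceQ : ∀ n, ∫ t in Ioo (-1 : ℝ) 0, ∫ x, Q n t x = ∫ t in Ioo a₁ b₁, ∫ x, Q n t x := by
    intro n
    refine setIntegral_eq_of_subset_of_forall_sdiff_eq_zero measurableSet_Ioo hIoo fun t ht => ?_
    have ht' : t ∉ Icc a' b' := fun h' => ht.2 ⟨ha₁a'.trans_le h'.1, h'.2.trans_lt hb'b₁⟩
    simp only [hQ0_t n t ht', integral_zero]
  rw [hreduce] at hpair'
  simp only [hreduce] at hid'
  simp_rw [hreduceQ]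
  -- Step 1: continuity of the test data; integrability of the limit slices
  set NU : ℝ≥0∞ := eLpNorm V 2 (volume.restrict (ball (0 : EuclideanSpace ℝ (Fin 3)) 1)) with hNU
  have hNUtop : NU ≠ ⊤ := hV2.ne
  set K₁ : ℝ≥0∞ := ENNReal.ofReal (1 + |(1 : ℝ)|) * volume (ball (0 : EuclideanSpace ℝ (Fin 3)) 1) ^ (1 / 2 : ℝ)
    with hK₁
  have hK₁top : K₁ ≠ ⊤ := ENNReal.mul_ne_top ENNReal.ofReal_ne_top
    (ENNReal.rpow_ne_top_of_nonneg (by norm_num) measure_ball_lt_top.ne)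
  have hBU : ENNReal.ofReal M₀ * NU * (K₁ + NU) ≠ ⊤ :=
    ENNReal.mul_ne_top (ENNReal.mul_ne_top ENNReal.ofReal_ne_top hNUtop)
      (ENNReal.add_ne_top.2 ⟨hK₁top, hNUtop⟩)
  have c1 : Continuous (uncurry (timeDeriv ψ)) := hψ.continuous_timeDeriv
  have c2 : Continuous fun z : ℝ × EuclideanSpace ℝ (Fin 3) => fderiv ℝ (ψ z.1) z.2 := by
    have := ((hψ.isSmoothSpaceTimeOn univ).fderiv_slice uniqueDiffOn_univ).continuousOn
    rwa [univ_prod_univ, continuousOn_univ] at this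
  have c3 : Continuous fun z : ℝ × EuclideanSpace ℝ (Fin 3) => Δ (ψ z.1) z.2 := by
    have := ((hψ.isSmoothSpaceTimeOn univ).laplacian uniqueDiffOn_univ).continuousOn
    rwa [univ_prod_univ, continuousOn_univ] at this
  have cd : ∀ t, Continuous (timeDeriv ψ t) := fun t => c1.comp (Continuous.prodMk_right t)
  have cD : ∀ t, Continuous fun x => fderiv ℝ (ψ t) x := fun t => c2.comp (Continuous.prodMk_right t)
  have cL : ∀ t, Continuous fun x => Δ (ψ t) x := fun t =>
    continuous_laplacian (contDiff_infty.1 (hψ.contDiff_slice t) 2)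
  have hU_lint : ∀ t, ∫⁻ x, ‖Fn (fun _ => V) t x‖ₑ ≤ ENNReal.ofReal M₀ * NU * (K₁ + NU) := fun t =>
    lintegral_veryWeakIntegrand_le (ν := 1) (hMt t) (hzero_x t) hVm
  have hintU : ∀ t, Integrable (Fn (fun _ => V) t) volume := fun t =>
    ⟨aestronglyMeasurable_veryWeakIntegrand hVm (cd t) (cD t) (cL t),
      hasFiniteIntegral_iff_enorm.2 ((hU_lint t).trans_lt hBU.lt_top)⟩
  have hU_prod : Integrable (fun z : ℝ × EuclideanSpace ℝ (Fin 3) => Fn (fun _ => V) z.1 z.2)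
      ((volume.restrict (Ioo a₁ b₁)).prod volume) := by
    have hm : AEStronglyMeasurable (fun z : ℝ × EuclideanSpace ℝ (Fin 3) => Fn (fun _ => V) z.1 z.2)
        ((volume.restrict (Ioo a₁ b₁)).prod volume) :=
      landauTail_aestronglyMeasurable_integrand (ν := 1) hVm.comp_snd c1.aestronglyMeasurable
        c2.aestronglyMeasurable c3.aestronglyMeasurable
    refine ⟨hm, ?_⟩
    rw [hasFiniteIntegral_iff_enorm, lintegral_prod _ hm.enorm]
    refine lt_of_le_of_lt (lintegral_mono fun t => hU_lint t) ?_
    rw [lintegral_const, Measure.restrict_apply_univ, Real.volume_Ioo]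
    exact ENNReal.mul_lt_top hBU.lt_top ENNReal.ofReal_lt_top
  have hFU_int : Integrable (fun t => ∫ x, Fn (fun _ => V) t x) (volume.restrict (Ioo a₁ b₁)) :=
    hU_prod.integral_prod_left
  -- Step 2: the approximants
  have hGcont : ∀ n, ContinuousOn (fun z : ℝ × EuclideanSpace ℝ (Fin 3) => Fn (u n) z.1 z.2)
      (Icc a₁ b₁ ×ˢ univ) := by
    intro n
    have hu : ContinuousOn (uncurry (u n)) (Icc a₁ b₁ ×ˢ univ) := (huc n).mono (prod_mono hIcc Subset.rfl)
    exact ((hu.inner c1.continuousOn).add (hu.inner (c2.continuousOn.clm_apply hu))).add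
      (continuousOn_const.mul (hu.inner c3.continuousOn))
  have hGzero : ∀ v, ∀ t ∈ Icc a₁ b₁, ∀ x ∉ closedBall (0 : EuclideanSpace ℝ (Fin 3)) 1,
      (fun z : ℝ × EuclideanSpace ℝ (Fin 3) => Fn v z.1 z.2) (t, x) = 0 := fun v t _ x hx =>
    hFn0_x v t x fun h => hx (ball_subset_closedBall h)
  have hslice_cont : ∀ n, ∀ t ∈ Ioo a₁ b₁, Continuous (u n t) ∧ Continuous fun x => Fn (u n) t x := by
    intro n t ht
    have hmaps : ∀ x ∈ (univ : Set (EuclideanSpace ℝ (Fin 3))),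
        (t, x) ∈ Icc a₁ b₁ ×ˢ (univ : Set (EuclideanSpace ℝ (Fin 3))) := fun x _ =>
      mk_mem_prod (Ioo_subset_Icc_self ht) (mem_univ x)
    have h1 : ContinuousOn (fun x => uncurry (u n) (t, x)) univ :=
      ((huc n).mono (prod_mono hIcc Subset.rfl)).comp (Continuous.prodMk_right t).continuousOn hmaps
    have hu : Continuous (u n t) := continuousOn_univ.1 h1
    refine ⟨hu, ?_⟩
    show Continuous fun x => ⟪u n t x, timeDeriv ψ t x⟫ + ⟪u n t x, fderiv ℝ (ψ t) x (u n t x)⟫ +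
      1 * ⟪u n t x, Δ (ψ t) x⟫
    exact ((hu.inner (cd t)).add (hu.inner ((cD t).clm_apply hu))).add
      (continuous_const.mul (hu.inner (cL t)))
  have hslice_int : ∀ n, ∀ t ∈ Ioo a₁ b₁, Integrable (fun x => Fn (u n) t x) volume := by
    intro n t ht
    refine (hslice_cont n t ht).2.integrable_of_hasCompactSupport ?_
    exact HasCompactSupport.intro (isCompact_closedBall (0 : EuclideanSpace ℝ (Fin 3)) 1) fun x hx =>
      hGzero (u n) t (Ioo_subset_Icc_self ht) x hx
  have hF_int : ∀ n, Integrable (fun t => ∫ x, Fn (u n) t x) (volume.restrict (Ioo a₁ b₁)) :=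
    fun n => (integrable_prod_of_continuousOn (isCompact_closedBall (0 : EuclideanSpace ℝ (Fin 3)) 1)
      (hGcont n) (hGzero (u n))).integral_prod_left
  -- Step 3: measurability of the deviations; the `L²(S)` bound as a bound on `∫_S |w|²`
  have hwmS : ∀ n, AEStronglyMeasurable (w n) μS := by
    intro n
    have h1 : AEStronglyMeasurable (fun z : ℝ × EuclideanSpace ℝ (Fin 3) => u n z.1 z.2) μS :=
      ((huc n).mono hSslab).aestronglyMeasurable hSm
    have h2 : AEStronglyMeasurable (fun z : ℝ × EuclideanSpace ℝ (Fin 3) => V z.2) μS := by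
      rw [hμS, Measure.volume_eq_prod]; exact hVm.comp_snd.restrict
    exact h1.sub h2
  have hVm2 : AEStronglyMeasurable (fun z : ℝ × EuclideanSpace ℝ (Fin 3) => V z.2) μS := by
    rw [hμS, Measure.volume_eq_prod]; exact hVm.comp_snd.restrict
  have hD2 : ∀ n, ∫⁻ z in S, ‖w n z‖ₑ ^ 2 ≤ (C : ℝ≥0∞) ^ 2 := by
    intro n
    have h := hbd n
    rw [eLpNorm_eq_lintegral_rpow_enorm_toReal two_ne_zero ENNReal.ofNat_ne_top, ENNReal.toReal_ofNat] at h
    have h2 := ENNReal.rpow_le_rpow h (by norm_num : (0 : ℝ) ≤ 2)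
    rw [← ENNReal.rpow_mul, show (1 / 2 : ℝ) * 2 = 1 by norm_num, ENNReal.rpow_one] at h2
    refine le_trans (le_of_eq ?_) (h2.trans (le_of_eq ?_))
    · refine lintegral_congr fun z => ?_
      show ‖u n z.1 z.2 - V z.2‖ₑ ^ (2 : ℕ) = ‖u n z.1 z.2 - V z.2‖ₑ ^ (2 : ℝ)
      rw [← ENNReal.rpow_natCast]; norm_num
    · rw [← ENNReal.rpow_natCast]; norm_num
  -- Step 4: the quadratic defect is integrable on the window × space
  set μI : Measure (ℝ × EuclideanSpace ℝ (Fin 3)) := (volume.restrict (Ioo a₁ b₁)).prod volume with hμI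
  have hμI_le : μI ≤ volume := by
    rw [hμI, Measure.volume_eq_prod, ← Measure.restrict_univ (μ := (volume : Measure (EuclideanSpace ℝ (Fin 3)))),
      Measure.prod_restrict, Measure.restrict_univ]
    exact Measure.restrict_le_self
  have hwmI : ∀ n, AEStronglyMeasurable (w n) μI := by
    intro n
    have h1 : AEStronglyMeasurable (fun z : ℝ × EuclideanSpace ℝ (Fin 3) => u n z.1 z.2)
        ((volume : Measure (ℝ × EuclideanSpace ℝ (Fin 3))).restrict (Ioo a₁ b₁ ×ˢ univ)) :=
      ((huc n).mono (prod_mono hIoo Subset.rfl)).aestronglyMeasurable (measurableSet_Ioo.prod MeasurableSet.univ)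
    have e : μI = (volume : Measure (ℝ × EuclideanSpace ℝ (Fin 3))).restrict (Ioo a₁ b₁ ×ˢ univ) := by
      rw [hμI, Measure.volume_eq_prod,
        ← Measure.restrict_univ (μ := (volume : Measure (EuclideanSpace ℝ (Fin 3)))), Measure.prod_restrict,
        Measure.restrict_univ]
    rw [e]
    refine h1.sub ?_
    rw [Measure.volume_eq_prod]
    exact hVm.comp_snd.restrict
  have hQm : ∀ n, AEStronglyMeasurable (fun z : ℝ × EuclideanSpace ℝ (Fin 3) => Q n z.1 z.2) μI := by
    intro n
    have hDm : AEStronglyMeasurable (fun z : ℝ × EuclideanSpace ℝ (Fin 3) => fderiv ℝ (ψ z.1) z.2) μI :=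
      c2.aestronglyMeasurable
    have h2 : AEStronglyMeasurable (fun z : ℝ × EuclideanSpace ℝ (Fin 3) => fderiv ℝ (ψ z.1) z.2 (w n z)) μI := by
      have := ContinuousLinearMap.aestronglyMeasurable_comp₂
        (ContinuousLinearMap.id ℝ (EuclideanSpace ℝ (Fin 3) →L[ℝ] EuclideanSpace ℝ (Fin 3))) hDm (hwmI n)
      simpa using this
    exact (hwmI n).inner h2
  have hQ_bound : ∀ n (z : ℝ × EuclideanSpace ℝ (Fin 3)),
      ‖Q n z.1 z.2‖ₑ ≤ S.indicator (fun z => ENNReal.ofReal M₀ * ‖w n z‖ₑ ^ 2) z := by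
    intro n z
    by_cases hz : z ∈ S
    · rw [indicator_of_mem hz]
      have h2 := (hMt z.1 z.2).2.1
      have hM0 : 0 ≤ M₀ := (norm_nonneg _).trans h2
      have key : ‖Q n z.1 z.2‖ ≤ M₀ * (‖w n z‖ * ‖w n z‖) := by
        calc ‖Q n z.1 z.2‖ ≤ ‖u n z.1 z.2 - V z.2‖ * ‖fderiv ℝ (ψ z.1) z.2 (u n z.1 z.2 - V z.2)‖ :=
              norm_inner_le_norm _ _
          _ ≤ ‖u n z.1 z.2 - V z.2‖ * (M₀ * ‖u n z.1 z.2 - V z.2‖) := by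
              refine mul_le_mul_of_nonneg_left ?_ (norm_nonneg _)
              exact (ContinuousLinearMap.le_opNorm _ _).trans (mul_le_mul_of_nonneg_right h2 (norm_nonneg _))
          _ = M₀ * (‖w n z‖ * ‖w n z‖) := by simp only [hw]; ring
      rw [← ofReal_norm, ← ofReal_norm (w n z), sq, ← ENNReal.ofReal_mul (norm_nonneg _),
        ← ENNReal.ofReal_mul hM0]
      exact ENNReal.ofReal_le_ofReal key
    · rw [indicator_of_notMem hz]
      have : Q n z.1 z.2 = 0 := hQ0_S n z.1 z.2 (by simpa using hz)
      rw [this, enorm_zero]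
  have hQ_prod : ∀ n, Integrable (fun z : ℝ × EuclideanSpace ℝ (Fin 3) => Q n z.1 z.2) μI := by
    intro n
    refine ⟨hQm n, ?_⟩
    rw [hasFiniteIntegral_iff_enorm]
    calc ∫⁻ z, ‖Q n z.1 z.2‖ₑ ∂μI
        ≤ ∫⁻ z, S.indicator (fun z => ENNReal.ofReal M₀ * ‖w n z‖ₑ ^ 2) z ∂μI := lintegral_mono (hQ_bound n)
      _ ≤ ∫⁻ z, S.indicator (fun z => ENNReal.ofReal M₀ * ‖w n z‖ₑ ^ 2) z := lintegral_mono' hμI_le le_rfl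
      _ = ENNReal.ofReal M₀ * ∫⁻ z in S, ‖w n z‖ₑ ^ 2 := by
          rw [lintegral_indicator hSm, lintegral_const_mul'' _ ((hwmS n).enorm.pow_const _)]
      _ < ⊤ := ENNReal.mul_lt_top ENNReal.ofReal_lt_top ((hD2 n).trans_lt (ENNReal.pow_lt_top ENNReal.coe_lt_top))
  have hQT_int : ∀ n, Integrable (fun t => ∫ x, Q n t x) (volume.restrict (Ioo a₁ b₁)) := fun n =>
    (hQ_prod n).integral_prod_left
  have hQslice : ∀ n, ∀ᵐ t ∂(volume.restrict (Ioo a₁ b₁)), Integrable (fun x => Q n t x) volume := fun n =>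
    (hQ_prod n).prod_right_ae
  -- Step 5: the exact split on slices and in time
  have hsliceQ : ∀ n, ∀ᵐ t ∂(volume.restrict (Ioo a₁ b₁)),
      ∫ x, Q n t x = ((∫ x, Fn (u n) t x) - ∫ x, Fn (fun _ => V) t x) - ∫ x, Lin n t x := by
    intro n
    filter_upwards [hQslice n, ae_restrict_mem measurableSet_Ioo] with t hQt ht
    have hL : Integrable (fun x => Lin n t x) volume := by
      have h := ((hslice_int n t ht).sub (hintU t)).sub hQt
      refine h.congr (ae_of_all _ fun x => ?_)
      simp only [hLin, Pi.sub_apply]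
    have h1 : ∫ x, (Fn (u n) t x - Fn (fun _ => V) t x) = (∫ x, Fn (u n) t x) - ∫ x, Fn (fun _ => V) t x :=
      integral_sub (hslice_int n t ht) (hintU t)
    have h2 : ∫ x, ((Fn (u n) t x - Fn (fun _ => V) t x) - Q n t x) =
        (∫ x, (Fn (u n) t x - Fn (fun _ => V) t x)) - ∫ x, Q n t x :=
      integral_sub ((hslice_int n t ht).sub (hintU t)) hQt
    have e1 : ∫ x, Lin n t x = ((∫ x, Fn (u n) t x) - ∫ x, Fn (fun _ => V) t x) - ∫ x, Q n t x := by
      rw [← h1, ← h2]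
    rw [e1]
    ring
  have hLinT_int : ∀ n, Integrable (fun t => ∫ x, Lin n t x) (volume.restrict (Ioo a₁ b₁)) := by
    intro n
    have h := ((hF_int n).sub hFU_int).sub (hQT_int n)
    refine h.congr ?_
    filter_upwards [hsliceQ n] with t ht
    simp only [Pi.sub_apply, ht]
    ring
  have hsplit : ∀ n, ∫ t in Ioo a₁ b₁, ∫ x, Q n t x =
      -(∫ t in Ioo a₁ b₁, ∫ x, Fn (fun _ => V) t x) - ∫ t in Ioo a₁ b₁, ∫ x, Lin n t x := by
    intro n
    rw [integral_congr_ae (hsliceQ n)]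
    have e1 : ∫ t in Ioo a₁ b₁, (((∫ x, Fn (u n) t x) - ∫ x, Fn (fun _ => V) t x) - ∫ x, Lin n t x) =
        (∫ t in Ioo a₁ b₁, ((∫ x, Fn (u n) t x) - ∫ x, Fn (fun _ => V) t x)) -
          ∫ t in Ioo a₁ b₁, ∫ x, Lin n t x :=
      integral_sub ((hF_int n).sub hFU_int) (hLinT_int n)
    have e2 : ∫ t in Ioo a₁ b₁, ((∫ x, Fn (u n) t x) - ∫ x, Fn (fun _ => V) t x) =
        (∫ t in Ioo a₁ b₁, ∫ x, Fn (u n) t x) - ∫ t in Ioo a₁ b₁, ∫ x, Fn (fun _ => V) t x :=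
      integral_sub (hF_int n) hFU_int
    rw [e1, e2, hid' n, zero_sub]
  -- Step 6: the linear part is small: `‖∫∫ Lin n‖ₑ ≤ 2M₀ T₁ n + 2M₀ T₂ n → 0`
  set glin : ℕ → ℝ × EuclideanSpace ℝ (Fin 3) → ℝ≥0∞ := fun n z =>
    ENNReal.ofReal (2 * M₀) * ‖w n z‖ₑ + ENNReal.ofReal (2 * M₀) * (‖V z.2‖ₑ * ‖w n z‖ₑ) with hglin
  have hglinm : ∀ n, AEMeasurable (glin n) μS := fun n =>
    ((hwmS n).enorm.const_mul _).add ((hVm2.enorm.mul (hwmS n).enorm).const_mul _)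
  have hGm : ∀ n, AEMeasurable (S.indicator (glin n)) (volume : Measure (ℝ × EuclideanSpace ℝ (Fin 3))) :=
    fun n => (aemeasurable_indicator_iff hSm).2 (hglinm n)
  have hLin_pt : ∀ n t x, ‖Lin n t x‖ₑ ≤ S.indicator (glin n) (t, x) := by
    intro n t x
    by_cases hz : (t, x) ∈ S
    · rw [indicator_of_mem hz, hLin_eq]
      obtain ⟨h1, h2, h3⟩ := hMt t x
      have hM0 : 0 ≤ M₀ := (norm_nonneg _).trans h1
      have key := landauTail_norm_linear_part_le (u n t x - V x) (V x) (timeDeriv ψ t x) (Δ (ψ t) x)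
        (fderiv ℝ (ψ t) x) M₀ h1 h2 h3
      have hw' : w n (t, x) = u n t x - V x := rfl
      rw [hglin]
      dsimp only
      rw [hw', ← ofReal_norm, ← ofReal_norm (u n t x - V x), ← ofReal_norm (V x),
        ← ENNReal.ofReal_mul (by positivity), ← ENNReal.ofReal_mul (norm_nonneg _),
        ← ENNReal.ofReal_mul (by positivity), ← ENNReal.ofReal_add (by positivity) (by positivity)]
      exact ENNReal.ofReal_le_ofReal key
    · rw [indicator_of_notMem hz, hLin0_S n t x hz, enorm_zero]
  set T₁ : ℕ → ℝ≥0∞ := fun n => ∫⁻ z in S, ‖w n z‖ₑ with hT₁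
  set T₂ : ℕ → ℝ≥0∞ := fun n => ∫⁻ z in S, ‖V z.2‖ₑ * ‖w n z‖ₑ with hT₂
  have hLbound : ∀ n, ‖∫ t in Ioo a₁ b₁, ∫ x, Lin n t x‖ₑ ≤
      ENNReal.ofReal (2 * M₀) * T₁ n + ENNReal.ofReal (2 * M₀) * T₂ n := by
    intro n
    calc ‖∫ t in Ioo a₁ b₁, ∫ x, Lin n t x‖ₑ
        ≤ ∫⁻ t in Ioo a₁ b₁, ‖∫ x, Lin n t x‖ₑ := enorm_integral_le_lintegral_enorm _
      _ ≤ ∫⁻ t in Ioo a₁ b₁, ∫⁻ x, S.indicator (glin n) (t, x) :=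
          lintegral_mono fun t => (enorm_integral_le_lintegral_enorm _).trans (lintegral_mono fun x => hLin_pt n t x)
      _ ≤ ∫⁻ t, ∫⁻ x, S.indicator (glin n) (t, x) := lintegral_mono' Measure.restrict_le_self le_rfl
      _ = ∫⁻ z, S.indicator (glin n) z ∂((volume : Measure ℝ).prod (volume : Measure (EuclideanSpace ℝ (Fin 3)))) := by
          rw [lintegral_lintegral, ← Measure.volume_eq_prod]
          exact hGm n
      _ = ∫⁻ z in S, glin n z := by rw [← Measure.volume_eq_prod, lintegral_indicator hSm]
      _ = ENNReal.ofReal (2 * M₀) * T₁ n + ENNReal.ofReal (2 * M₀) * T₂ n := by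
          have h1 : AEMeasurable (fun z => ‖w n z‖ₑ) μS := (hwmS n).enorm
          have m2 : AEMeasurable (fun z => ENNReal.ofReal (2 * M₀) * ‖w n z‖ₑ) μS := h1.const_mul _
          show ∫⁻ z, glin n z ∂μS = _
          simp only [hglin]
          rw [lintegral_add_left' m2, lintegral_const_mul' _ _ ENNReal.ofReal_ne_top,
            lintegral_const_mul' _ _ ENNReal.ofReal_ne_top]
  -- the linear part tends to zero (Vitali at exponents `1` and `5/3`, Hölder against `V ∈ L^{5/2}`)
  have hae0 : ∀ᵐ z ∂μS, Tendsto (fun n => w n z) atTop (𝓝 0) := by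
    filter_upwards [hae] with z hz
    have h := hz.sub_const (V z.2)
    rwa [sub_self] at h
  set B : ℕ → ℝ≥0∞ := fun n => ENNReal.ofReal (2 * M₀) * T₁ n + ENNReal.ofReal (2 * M₀) * T₂ n with hB
  have hB0 : Tendsto B atTop (𝓝 0) :=
    landauTail_linear_terms_tendsto_zero w V s₁ s₂ ρ (2 * M₀) C hρ1 hVm hV52 hwmS hbd hae0
  -- Step 7: conclusion
  set Lval : ℝ := Φ * ∫ t in Ioo (-1 : ℝ) 0, ⟪a, ψ t 0⟫ with hLval
  have hval : -(∫ t in Ioo a₁ b₁, ∫ x, Fn (fun _ => V) t x) = Lval := by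
    rw [hpair', hLval]; ring
  rw [tendsto_iff_edist_tendsto_0]
  refine tendsto_of_tendsto_of_tendsto_of_le_of_le tendsto_const_nhds hB0 (fun _ => zero_le) fun n => ?_
  rw [edist_eq_enorm_sub, hsplit n, hval, show Lval - (∫ t in Ioo a₁ b₁, ∫ x, Lin n t x) - Lval =
    -(∫ t in Ioo a₁ b₁, ∫ x, Lin n t x) by ring, enorm_neg]
  exact hLbound n

end Summit.NavierStokesRegularity.NavierStokesRegularity.Theorems

end
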